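import Summits.ResolutionOfSingularities.ResolutionOfSingularities.Theorems.MaxContactCutFreezeCut
import HarnessLib

/-!
# FreezeCutDead — decomp-res node «ExtinctionCut» (lens-3 g20, critic row 156), tree file 1/8 of the node

Content VERBATIM from the decomp-res lens-3 g20 node `HOME/decomp-res-lens-3/g20/ExtinctionCut.lean` (pin c917c20b =
`parts/ExtinctionCut-g20-c917c20b.lean`, 1 323 l; HOME = run/shared/lean/pub/decomp-res; lens imports = tree
`MaxContactCutFreezeCut` +
`StallVertexStraightClasses` only; rc 0 · 0 sorry).  Critic: CRITIC-LEDGER row 156 (2026-08-31T00:18:27Z):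
DECIDED-MOD-PORT +1 — the BALANCED
BOUNDARY CLASS `FreezeCut.NoBalancedBoundaryTailsDeep` decided AS A WHOLE modulo ONE typed port
`ExtinctionCut.KollarWallPort`.  Landing orders
INBOX :552 (critic) and :467 / :489 (the lens-3 g19 rev-4 blocks §D / §K7 = `FreezeCutDead` + classes add-on, land
first), `--kind proof --supports
stmt-ResolutionOfSingularities-31770` (`MaxContactCut.DefectWalksDeep`).  Files of the node, in import order:
`FreezeCutDead` (§D, namespace
`…HoleCut.TailShade`, over the in-cone `MaxContactCutFreezeCut`) · `FreezeCutDeadClasses` (§K7 classes, cone-free,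
namespace `…FreezeCut`) ·
`MaxContactCutFreezeCutDead` (§K7 kernels and EXACT iff's at 31770, Theses cone) · `ExtinctionCutToric` /
`ExtinctionCutToric2` (§1, Mathlib only,
namespace `…ExtinctionCut`) · `ExtinctionCutPort` (§2, the ONE typed port `KollarWallPort`, cone-free so that the
route file can cite it as an item) ·
`MaxContactCutExtinctionCut` (§3 booking at 31770, Theses cone; §M `closes` = tree
`MaxContactCutExponentLadder.closes` verbatim is omitted, as in
`MaxContactCutFreezeCut`).  Aside bookkeeping (row 156 / INBOX :552): on the lens-3 column ONE typed PORT item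
`KollarWallPort` and ONE live aside
`FreezeCut.NoSmallDeadStrictHighSkewJointTailsDeep` (home `FreezeCutDeadClasses`) superseding the rev-4 sub-class
pair; decided cells are THEOREMS and
are not filed.

## This file

§D (lens-3 g19 rev 4, KERNEL, in `namespace TailShade` of `…Theorems.HoleCut`, `section DeadLaw`): THE DEAD-SUPPORT
AND BALANCE LAWS on a supercritical skew-joint tail — `nat_eventually_const`; `planar_of_never_twoOrDead`,
`dead_from`, `small_of_stays_dead`, D4 **`eventually_smallDead_of_skew`** (the dead support is eventually SMALL),
`eventually_degree_drop_of_skew`, `eventually_const_degree_of_skew`, `boundary_shape`, D7 **`balanced_of_skew`** (on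
the boundary line `p^e + 1 = 2s` the late multiplicity vector is a permutation of `(0, s−1, s−1)`).  Imports the
in-cone `MaxContactCutFreezeCut` (the `TailShade` cone-variable machinery `FreezeCutConeVars` / `FreezeCutLaw` /
`FreezeCutHalf` and the rev-2 classes).

[WRITER NOTE (decomp-res writer g9): file split only (tree files ≤ 400 lines); namespaces, sections, section
variables and every declaration
exactly as in the lens (the lens's global opens are replayed per file; cone-free files carry the opens of
`FreezeCutClasses.lean`, the toric kernel none).]

(Sources: Kollar2007 (Lectures on Resolution of Singularities: Thm 1.93, Def 2.56, Rem 2.57, Claim 2.59.1, (2.59.2),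
Claim 2.59.4) [corpus:book:kollar2007-lectures-resolution-singularities pp. 54, 92–94]; Hauser2010Kangaroo
(arXiv:0811.4151); Moh1987; CossartPiltant2008 §2; CossartPiltant2019 Prop. 2.50; HauserPerlega2019 §1.)
-/

noncomputable section

open MvPolynomial Finset
open Literature.AlgebraicGeometry.Resolution
open Literature.AlgebraicGeometry.Resolution.Hauser2010
open Literature.AlgebraicGeometry.Resolution.PointBlowup
open Summit.ResolutionOfSingularities.ResolutionOfSingularities.Theses
open Summit.ResolutionOfSingularities.ResolutionOfSingularities.Theorems.TightDefectClasses
open Summit.ResolutionOfSingularities.ResolutionOfSingularities.Theorems.TightDefectStrongWalks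
open Summit.ResolutionOfSingularities.ResolutionOfSingularities.Theorems.ItineraryCutClasses
open Summit.ResolutionOfSingularities.ResolutionOfSingularities.Theorems.BoundaryLedger
open Summit.ResolutionOfSingularities.ResolutionOfSingularities.Theorems.ProximityCut
open Summit.ResolutionOfSingularities.ResolutionOfSingularities.Theorems.ConeCutAxisLaw
open Literature.AlgebraicGeometry.Resolution.WeightedBlowup
open Literature.Barriers.ResolutionOfSingularities
open Summit.ResolutionOfSingularities.ResolutionOfSingularities.Theorems.FloorCut
open Summit.ResolutionOfSingularities.ResolutionOfSingularities.Theorems.ConeCut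
open Summit.ResolutionOfSingularities.ResolutionOfSingularities.Theorems.ExitLaw (fin3_cases eq_of_le_of_degree_le)
open Summit.ResolutionOfSingularities.ResolutionOfSingularities.Theorems.ShadeCut
open Summit.ResolutionOfSingularities.ResolutionOfSingularities.Theorems.TightCut
open Summit.ResolutionOfSingularities.ResolutionOfSingularities.Theorems.HoleCut

namespace Summit.ResolutionOfSingularities.ResolutionOfSingularities.Theorems.HoleCut

section DeadLaw

variable {K : Type} [Field K] [DecidableEq K] {q : ℕ} {s₀ : State (Fin 3) K}

/-! ## §D THE DEAD-SUPPORT AND BALANCE LAWS (lens-3 g19 rev 4 §D = `HOME/decomp-res-lens-3/g19/FreezeCut.lean`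
sha256 9cd2ec7d… l. 4986–5333,
carried VERBATIM in the g20 node l. 48–383 but for three `exists_third` call sites adapted to the tree signature
`ConeCutRepeats.exists_third {a c} (hac)`; tree namespace `…Theorems.HoleCut.TailShade` like `FreezeCutHalf.lean`). -/

/-- An eventually non-increasing sequence of naturals is eventually constant. [folklore] -/
theorem nat_eventually_const {f : ℕ → ℕ} {N' : ℕ} (hf : ∀ t, N' ≤ t → f (t + 1) ≤ f t) :
    ∃ M, N' ≤ M ∧ ∀ t, M ≤ t → f t = f M := by
  classical
  have hP : ∃ m, ∃ t, N' ≤ t ∧ f t = m := ⟨f N', N', le_rfl, rfl⟩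
  obtain ⟨t₀, ht₀, hft₀⟩ := Nat.find_spec hP
  refine ⟨t₀, ht₀, ?_⟩
  intro t ht
  have hmono : ∀ t, t₀ ≤ t → f t ≤ f t₀ := by
    intro t ht
    induction t, ht using Nat.le_induction with
    | base => exact le_rfl
    | succ t ht ih => exact (hf t (by omega)).trans ih
  have hmin : Nat.find hP ≤ f t := Nat.find_min' hP ⟨t, by omega, rfl⟩
  have := hmono t ht
  omega

namespace TailShade

variable {W : ForcedWalk q s₀} {N n : ℕ}

/-- (D1) A tail of shade `n ≥ 1` and positive excess that NEVER carries two cone variables or a dead support is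
PLANAR: one coordinate is never the chart and never translated (it is the frozen lone cone variable; band-free core
of F4). [new] [folklore] -/
theorem planar_of_never_twoOrDead (hroot : IsRoot q s₀) (hn1 : 1 ≤ n) (h : TailShade W N n)
    (hnever : ∀ t, N ≤ t → ¬ (TwoConeVars W t ∨ ∃ x, DeadSupport W t x)) :
    ∃ k : Fin 3, ∀ t, N ≤ t → W.j t ≠ k ∧ W.b t k = 0 := by
  classical
  have hone : ∀ t, N ≤ t → ∀ x y, ConeVar W t x → ConeVar W t y → x = y := by
    intro t ht x y hx hy
    by_contra hxy
    exact hnever t ht (Or.inl ⟨x, y, hxy, hx, hy⟩)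
  obtain ⟨o, ho, hqo, hplat, hn, -⟩ := h.stage hroot N le_rfl
  obtain ⟨k, -, hck⟩ := exists_coneVar_ne_chart hroot W N ho hqo hplat hn hn1
  refine ⟨k, ?_⟩
  have hall : ∀ t, N ≤ t → ConeVar W t k := by
    intro t ht
    induction t, ht using Nat.le_induction with
    | base => exact hck
    | succ t ht ih =>
      obtain ⟨o, ho, hqo, hplat, hn, -⟩ := h.stage hroot t ht
      obtain ⟨x, hxj, hcx⟩ := exists_coneVar_ne_chart hroot W t ho hqo hplat hn hn1
      have hxk : x = k := hone t ht x k hcx ih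
      rw [hxk] at hxj
      exact coneVar_succ hroot W t ho hqo hplat hn hxj ih
  intro t ht
  obtain ⟨o, ho, hqo, hplat, hn, -⟩ := h.stage hroot t ht
  obtain ⟨x, hxj, hcx⟩ := exists_coneVar_ne_chart hroot W t ho hqo hplat hn hn1
  have hxk : x = k := hone t ht x k hcx (hall t ht)
  rw [hxk] at hxj
  exact ⟨fun h' => hxj h'.symm,
    b_eq_zero_of_coneVar_subset hroot W t ho hqo hplat hn hn1 hxj fun y hy => hone t ht y k hy (hall t ht)⟩

/-- (D2) After a stage carrying two cone variables or a dead support and ONE later translated move, the tail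
carries a DEAD SUPPORT at every stage (F1 iterated, F2 once, then persistence). [new] [folklore] -/
theorem dead_from (hroot : IsRoot q s₀) (hn1 : 1 ≤ n) (h : TailShade W N n) {t₀ : ℕ} (ht₀ : N ≤ t₀)
    (hJ₀ : TwoConeVars W t₀ ∨ ∃ x, DeadSupport W t₀ x) (htr : ∀ M, ∃ t, M ≤ t ∧ W.b t ≠ 0) :
    ∃ t₁, N ≤ t₁ ∧ ∀ d, ∃ x, DeadSupport W (t₁ + d) x := by
  classical
  have hJ : ∀ t, t₀ ≤ t → TwoConeVars W t ∨ ∃ x, DeadSupport W t x := by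
    intro t ht
    induction t, ht using Nat.le_induction with
    | base => exact hJ₀
    | succ t ht ih => exact h.twoOrDead_succ hroot hn1 t (by omega) ih
  obtain ⟨t₁, ht₁, hb⟩ := htr t₀
  refine ⟨t₁ + 1, by omega, ?_⟩
  intro d
  induction d with
  | zero => exact h.dead_succ_of_translated hroot hn1 t₁ (by omega) (hJ t₁ ht₁) hb
  | succ d ih =>
    rw [show t₁ + 1 + (d + 1) = t₁ + 1 + d + 1 by omega]
    exact h.dead_succ hroot hn1 (t₁ + 1 + d) (by omega) ih

/-- (D3) A proximity repeat taken at a POOR stage `t` in front of a DEAD SUPPORT at `t + 1` makes stage `t + 2`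
SMALL: every multiplicity is `≤ n − 1` (newest masses `δ_{t+1}, δ_t` and a zero; band-free half of H3). [new] [folklore] -/
theorem small_of_stays_dead (hroot : IsRoot q s₀) (h : TailShade W N n) (t : ℕ) (ht : N ≤ t)
    (hz0 : HasZero W t) (hd1 : ∃ x, DeadSupport W (t + 1) x) (hS : StaysOnNewest W t) :
    ∀ y, (W.st (t + 2)).r y + 1 ≤ n := by
  classical
  obtain ⟨hne, hbn⟩ := hS
  obtain ⟨x, hcx, hrx⟩ := hd1
  have hD0 := degree_lt_of_hasZero hroot W t hz0
  have hD1 := degree_lt_of_hasZero hroot W (t + 1) ⟨x, hrx⟩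
  obtain ⟨-, hnew0, -⟩ := h.step hroot t ht
  obtain ⟨-, hnew1, hkeep1⟩ := h.step hroot (t + 1) (by omega)
  have hw0 := h.degree_window hroot t ht
  have hxj : x ≠ W.j t := by
    intro h'
    rw [h'] at hrx
    omega
  obtain ⟨m, hmn, hmc⟩ := exists_third hne.symm
  obtain ⟨-, hkm⟩ := TailThree.kept_three W t hne hmn hmc hbn
  have hkm0 : kept W (t + 1) m = 0 := by
    by_cases hcx' : W.j (t + 1) = x
    · by_cases hb : W.b (t + 1) = 0
      · exfalso
        obtain ⟨o, ho, hqo, hplat, hn, -⟩ := h.stage hroot (t + 1) (by omega)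
        refine not_coneVar_chart_of_untranslated hroot W (t + 1) ho hqo hplat hn hb ?_
        rw [hcx']
        exact hcx
      · have hbm : W.b (t + 1) m ≠ 0 := by
          intro hbm
          apply hb
          funext l
          rcases fin3_cases hne.symm hmn hmc l with hl | hl | hl <;> rw [hl]
          · exact hbn
          · exact W.onExc (t + 1)
          · exact hbm
        rw [hkm, if_neg hbm]
    · have hxm : x = m := by
        rcases fin3_cases hne.symm hmn hmc x with hl | hl | hl
        · exact absurd hl hxj
        · exact absurd hl.symm hcx'
        · exact hl
      rw [hkm]
      split_ifs
      · rw [← hxm]; exact hrx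
      · rfl
  have hjt : (W.st (t + 2)).r (W.j t) = (W.st (t + 1)).r (W.j t) := by
    rw [show t + 2 = t + 1 + 1 from rfl, hkeep1 (W.j t) hne.symm, kept_of_ne W (t + 1) hne.symm, if_pos hbn]
  have hmt : (W.st (t + 2)).r m = 0 := by
    rw [show t + 2 = t + 1 + 1 from rfl, hkeep1 m hmc, hkm0]
  intro y
  rcases fin3_cases hne.symm hmn hmc y with hl | hl | hl <;> rw [hl]
  · rw [hjt]; omega
  · rw [show t + 2 = t + 1 + 1 from rfl]; omega
  · rw [hmt]; omega

/-- **(D4) THE DEAD-SUPPORT LAW (PROVED, NO BAND HYPOTHESIS).**  On a tail of shade `n ≥ 1` and positive excess,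
with proximity repeats and translated moves recurring, which is SKEW (every coordinate is charted or translated
again and again — lens-5's letter `¬ PlanarFrom`), from some stage on EVERY stage is SMALL (`r_y ≤ n − 1` for all
`y`) AND CARRIES A DEAD SUPPORT (a cone variable of multiplicity `0`). [new] [folklore] -/
theorem eventually_smallDead_of_skew (hroot : IsRoot q s₀) (hn1 : 1 ≤ n) (h : TailShade W N n)
    (hrep : ∀ M, ∃ t, M ≤ t ∧ StaysOnNewest W t) (htr : ∀ M, ∃ t, M ≤ t ∧ W.b t ≠ 0)
    (hskew : ∀ (k : Fin 3) (N' : ℕ), ∃ t, N' ≤ t ∧ (W.j t = k ∨ W.b t k ≠ 0)) :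
    ∃ N', N ≤ N' ∧ ∀ t, N' ≤ t → (∀ y, (W.st t).r y + 1 ≤ n) ∧ ∃ x, DeadSupport W t x := by
  classical
  -- some stage carries two cone variables or a dead support (else the tail is planar by D1, against skewness)
  obtain ⟨t₀, ht₀, hJ₀⟩ : ∃ t₀, N ≤ t₀ ∧ (TwoConeVars W t₀ ∨ ∃ x, DeadSupport W t₀ x) := by
    by_contra hno
    obtain ⟨k, hk⟩ := h.planar_of_never_twoOrDead hroot hn1 fun t ht hP => hno ⟨t, ht, hP⟩
    obtain ⟨t, hNt, ht⟩ := hskew k N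
    obtain ⟨hj, hb⟩ := hk t hNt
    rcases ht with ht | ht
    · exact hj ht
    · exact ht hb
  -- dead supports (hence poverty) forever, from some stage `t₁` on (D2)
  obtain ⟨t₁, ht₁, hdead⟩ := h.dead_from hroot hn1 ht₀ hJ₀ htr
  have hzero : ∀ d, HasZero W (t₁ + d) := fun d => by
    obtain ⟨x, -, hrx⟩ := hdead d
    exact ⟨x, hrx⟩
  -- the next proximity repeat makes the tail small (D3), and smallness persists (H1)
  obtain ⟨u, hu, hS⟩ := hrep t₁
  obtain ⟨d, rfl⟩ : ∃ d, u = t₁ + d := ⟨u - t₁, by omega⟩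
  have hd1 : ∃ x, DeadSupport W (t₁ + d + 1) x := by
    have := hdead (d + 1)
    rwa [show t₁ + (d + 1) = t₁ + d + 1 by omega] at this
  have hsmall2 := h.small_of_stays_dead hroot (t₁ + d) (by omega) (hzero d) hd1 hS
  refine ⟨t₁ + d + 2, by omega, ?_⟩
  intro t ht
  obtain ⟨e, rfl⟩ : ∃ e, t = t₁ + d + 2 + e := ⟨t - (t₁ + d + 2), by omega⟩
  clear ht
  refine ⟨?_, ?_⟩
  · induction e with
    | zero => simpa using hsmall2
    | succ e ih =>
      rw [show t₁ + d + 2 + (e + 1) = t₁ + d + 2 + e + 1 by omega]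
      have hz : HasZero W (t₁ + d + 2 + e) := by
        have := hzero (d + 2 + e)
        rwa [show t₁ + (d + 2 + e) = t₁ + d + 2 + e by omega] at this
      exact h.small_succ hroot (t₁ + d + 2 + e) (by omega) hz ih
  · have := hdead (d + 2 + e)
    rwa [show t₁ + (d + 2 + e) = t₁ + d + 2 + e by omega] at this

/-- (D5) Hence the MASS LEDGER `D_{t+1} + q + 1 ≤ D_t + 2n` (H2) holds at every late stage of a skew joint tail —
at every `(q, n)`. [new] [folklore] -/
theorem eventually_degree_drop_of_skew (hroot : IsRoot q s₀) (hn1 : 1 ≤ n) (h : TailShade W N n)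
    (hrep : ∀ M, ∃ t, M ≤ t ∧ StaysOnNewest W t) (htr : ∀ M, ∃ t, M ≤ t ∧ W.b t ≠ 0)
    (hskew : ∀ (k : Fin 3) (N' : ℕ), ∃ t, N' ≤ t ∧ (W.j t = k ∨ W.b t k ≠ 0)) :
    ∃ N', N ≤ N' ∧ ∀ t, N' ≤ t → (W.st (t + 1)).r.degree + q + 1 ≤ (W.st t).r.degree + 2 * n := by
  obtain ⟨N', hN', hsd⟩ := h.eventually_smallDead_of_skew hroot hn1 hrep htr hskew
  exact ⟨N', hN', fun t ht => h.degree_drop hroot t (by omega) (hsd t ht).2 (hsd t ht).1⟩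

/-- (D6) **ON THE BOUNDARY LINE `q + 1 = 2n`** the boundary mass of a skew joint tail is EVENTUALLY CONSTANT (it is
eventually non-increasing by D5), every late stage being small with a dead support. [new] [folklore] -/
theorem eventually_const_degree_of_skew (hroot : IsRoot q s₀) (hq : q + 1 = 2 * n) (hn1 : 1 ≤ n)
    (h : TailShade W N n) (hrep : ∀ M, ∃ t, M ≤ t ∧ StaysOnNewest W t) (htr : ∀ M, ∃ t, M ≤ t ∧ W.b t ≠ 0)
    (hskew : ∀ (k : Fin 3) (N' : ℕ), ∃ t, N' ≤ t ∧ (W.j t = k ∨ W.b t k ≠ 0)) :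
    ∃ M, N ≤ M ∧ (∀ t, M ≤ t → (∀ y, (W.st t).r y + 1 ≤ n) ∧ ∃ x, DeadSupport W t x) ∧
      ∀ t, M ≤ t → (W.st t).r.degree = (W.st M).r.degree := by
  obtain ⟨N', hN', hsd⟩ := h.eventually_smallDead_of_skew hroot hn1 hrep htr hskew
  have hanti : ∀ t, N' ≤ t → (W.st (t + 1)).r.degree ≤ (W.st t).r.degree := by
    intro t ht
    have := h.degree_drop hroot t (by omega) (hsd t ht).2 (hsd t ht).1
    omega
  obtain ⟨M, hM, hconst⟩ := nat_eventually_const (f := fun t => (W.st t).r.degree) hanti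
  exact ⟨M, by omega, fun t ht => hsd t (by omega), hconst⟩

end TailShade

end DeadLaw

end Summit.ResolutionOfSingularities.ResolutionOfSingularities.Theorems.HoleCut
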